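import Literature.AlgebraicGeometry.Frobenioids.TwinPrimarySquares
import Literature.AlgebraicGeometry.Frobenioids.Thm49Sub
import HarnessLib

/-!
# [FrdI] Theorem 4.9, sub-DAG row T49-L08 («Ψ preserves twin-primary data»), proof p. 90 ll. 28–54 —
# the statement WITH print's "as in Proposition 4.1, (iii)" (co-primary cartesian squares), proved

Mochizuki, *The geometry of Frobenioids I: the general theory*, Kyushu J. Math. **62** (2008)
293–400, §4, proof of Theorem 4.9, kurims text p. 90 ll. 28–54 [cite: MochizukiFrdI2008, Thm. 4.9 p.90]:

> "Conversely, given any pair of cartesian diagrams of pre-steps AS IN PROPOSITION 4.1, (iii), … in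
> which `α`, `β` are primary with zero divisor in `𝔭`; the pre-steps `ζ := β ∘ γ`, `γ''` are
> Div-equivalent, it follows immediately that `α`, `β` are twin-primary. On the other hand, since `Ψ`
> preserves pre-steps [Thm. 3.4 (ii)], primary steps [Thm. 4.2 (i)], Div-equivalent pairs of
> base-isomorphisms [Thm. 4.2 (ii); `Φ_i` non-dilating], and cartesian diagrams as in Proposition 4.1,
> (iii) …, we thus conclude that … there exist twin-primary steps … that are mapped by `Ψ` to
> twin-primary steps of `C₂`."

PROOF-ONLY file (seat abc-iut-w4-d105; D-0068 sub-DAG S5, row `FrdI:Thm4.9/T49-L08`, L1-lead MENU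
M12). The statements file `Thm49Sub.lean` (seat abc-iut-L1-t14) types this row as
`FrdI.T49.PsiPreservesTwinPrimary` with the two squares required only to COMMUTE and to be CARTESIAN
AMONG PRE-STEPS. Print's phrase "as in Proposition 4.1, (iii)" means squares over CO-PRIMARY pairs —
those are the squares that carry the divisor identities `ε_*(ε'_*Div ε') = ι_*(Div ι)` (p. 75) on which
"it follows immediately" rests (`PreFrobenioid.prop41iii_identities_of_cartesian`); without
co-primarity the lattice `Order(Φ(A))` (Def. 1.3 (iii)(d)) admits cartesian squares with apex
`x_β ∨ x_δ`, `x_β ∧ x_δ ≠ 0`, for which the identities — and the conclusion `Div α = (Φ β)⁻¹ Div β` —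
fail, so the binder list of `PsiPreservesTwinPrimary` is not expected to be provable as it stands
(note to the typer, HOME/STATUS 2026-08-25T23:37Z). THIS file proves the row WITH the two printed
co-primarity hypotheses added, in the categorical form of Prop. 4.1 (iii) ("every pre-step through
which both factor is an isomorphism", `PreFrobenioidData.IsCoprimary`), which `Ψ` transports
(`PreFrobenioid.coprimary_map`): `FrdI.T49.isTwinPrimary_map_of_coprimary_squares`. Over
`FrdI.T42.Setting`; the inputs "Ψ preserves primary steps" (Thm. 4.2 (i), row T42-L07) and
"Ψ preserves Div-equivalent pairs of base-isomorphisms" (Thm. 4.2 (ii) + non-dilating) are the row's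
named hypotheses, exactly as in the statements file. No new definitions; nothing of [FrdI] is restated.
-/

namespace Literature.AlgebraicGeometry.Frobenioids

open CategoryTheory Opposite

namespace FrdI.T49

universe w v v' u u'

-- the `(F ⋙ G).obj X` / `G.obj (F.obj X)` bookkeeping under `Ψ` (as in the tree's `Equivalence*.lean`)
set_option backward.isDefEq.respectTransparency false

variable {D₁ : Type u} [Category.{v} D₁] {Φ₁ : D₁ᵒᵖ ⥤ CommMonCat.{w}} {C₁ : Type u'} [Category.{v'} C₁]
  {D₂ : Type u} [Category.{v} D₂] {Φ₂ : D₂ᵒᵖ ⥤ CommMonCat.{w}} {C₂ : Type u'} [Category.{v'} C₂]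

/-- **T49-L08 with print's co-primarity ("as in Proposition 4.1, (iii)")**: in the setting of Thm. 4.2
(`FrdI.T42.Setting`: Frobenioids of perfect and isotropic type, `Φ_i` perf-factorial, `Ψ` and `Ψ⁻¹`
preserving pre-steps and steps), with `Ψ` preserving primary steps [Thm. 4.2 (i)] and Div-equivalent
pairs of base-isomorphisms [Thm. 4.2 (ii)], let `α : A → F`, `β : B → A` be primary steps and
`γ, γ', δ, γ'', δ'` pre-steps forming commutative squares `δ ∘ γ' = β ∘ γ` (over `A`) and
`δ' ∘ γ' = α ∘ γ''` (over `F`), each cartesian among pre-steps, with `(δ, β)` and `(δ', α)` co-primary,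
and `ζ := β ∘ γ`, `γ''` Div-equivalent. Then `α`, `β` are twin-primary AND `Ψ α`, `Ψ β` are
twin-primary ([FrdI] p. 90 ll. 28–54). [cite: MochizukiFrdI2008, Thm. 4.9 p.90] -/
theorem isTwinPrimary_map_of_coprimary_squares (F₁ : C₁ ⥤ ElemFrobenioid Φ₁)
    (F₂ : C₂ ⥤ ElemFrobenioid Φ₂) (Ψ : C₁ ≌ C₂) (hS : T42.Setting F₁ F₂ Ψ)
    (hprim : ∀ ⦃X Y : C₁⦄ (φ : X ⟶ Y), PreFrobenioid.IsPrimaryPreStep F₁ φ →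
      PreFrobenioid.IsPrimaryPreStep F₂ (Ψ.functor.map φ))
    (hdiveq : ∀ ⦃X Y : C₁⦄ (φ ψ : X ⟶ Y), PreFrobenioid.IsBaseIso F₁ φ → PreFrobenioid.IsBaseIso F₁ ψ →
      PreFrobenioid.DivEquivalent F₁ φ ψ →
        PreFrobenioid.DivEquivalent F₂ (Ψ.functor.map φ) (Ψ.functor.map ψ))
    {A B C' D' F' : C₁} (α : A ⟶ F') (β : B ⟶ A) (γ : C' ⟶ B) (γ' : C' ⟶ D') (δ : D' ⟶ A)
    (γ'' : C' ⟶ A) (δ' : D' ⟶ F')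
    (hα : PreFrobenioid.IsStep F₁ α) (hαp : PreFrobenioid.IsPrimaryPreStep F₁ α)
    (hβ : PreFrobenioid.IsStep F₁ β) (hβp : PreFrobenioid.IsPrimaryPreStep F₁ β)
    (hγ : PreFrobenioid.IsPreStep F₁ γ) (hγ' : PreFrobenioid.IsPreStep F₁ γ')
    (hδ : PreFrobenioid.IsPreStep F₁ δ) (hγ'' : PreFrobenioid.IsPreStep F₁ γ'')
    (hδ' : PreFrobenioid.IsPreStep F₁ δ')
    (sq₁ : γ' ≫ δ = γ ≫ β) (sq₂ : γ' ≫ δ' = γ'' ≫ α)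
    (cart₁ : ∀ ⦃V : C₁⦄ (a : V ⟶ D') (b : V ⟶ B), PreFrobenioid.IsPreStep F₁ a →
      PreFrobenioid.IsPreStep F₁ b → a ≫ δ = b ≫ β → ∃! u : V ⟶ C', u ≫ γ' = a ∧ u ≫ γ = b)
    (cart₂ : ∀ ⦃V : C₁⦄ (a : V ⟶ D') (b : V ⟶ A), PreFrobenioid.IsPreStep F₁ a →
      PreFrobenioid.IsPreStep F₁ b → a ≫ δ' = b ≫ α → ∃! u : V ⟶ C', u ≫ γ' = a ∧ u ≫ γ'' = b)
    (cop₁ : ∀ ⦃Z : C₁⦄ (ζ : Z ⟶ A), PreFrobenioid.IsPreStep F₁ ζ →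
      (∃ (ε' : D' ⟶ Z) (ι' : B ⟶ Z), PreFrobenioid.IsPreStep F₁ ε' ∧ PreFrobenioid.IsPreStep F₁ ι' ∧
          ε' ≫ ζ = δ ∧ ι' ≫ ζ = β) → IsIso ζ)
    (cop₂ : ∀ ⦃Z : C₁⦄ (ζ : Z ⟶ F'), PreFrobenioid.IsPreStep F₁ ζ →
      (∃ (ε' : D' ⟶ Z) (ι' : A ⟶ Z), PreFrobenioid.IsPreStep F₁ ε' ∧ PreFrobenioid.IsPreStep F₁ ι' ∧
          ε' ≫ ζ = δ' ∧ ι' ≫ ζ = α) → IsIso ζ)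
    (hde : PreFrobenioid.DivEquivalent F₁ (γ ≫ β) γ'') :
    IsTwinPrimary F₁ α β ∧ IsTwinPrimary F₂ (Ψ.functor.map α) (Ψ.functor.map β) := by
  refine ⟨⟨hα, hαp, hβ, hβp, fun h => ?_⟩,
    ⟨hS.step_map α hα, hprim α hαp, hS.step_map β hβ, hprim β hβp, fun h => ?_⟩⟩
  · -- one Frobenioid: the computation over the co-primary squares of `C₁`
    exact PreFrobenioid.div_eq_invDiv_of_coprimary_squares F₁ hS.isFrobenioid₁ hS.perfect₁ hS.isotropic₁
      hS.perfFactorial₁ α β γ γ' δ γ'' δ' hα.1 hβ.1 hγ hγ' hδ hγ'' hδ' sq₁ sq₂ cart₁ cart₂ cop₁ cop₂ hde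
  · -- the image squares in `C₂`: commutative, cartesian among pre-steps, over co-primary pairs
    have sq₁' : Ψ.functor.map γ' ≫ Ψ.functor.map δ = Ψ.functor.map γ ≫ Ψ.functor.map β := by
      rw [← Ψ.functor.map_comp, sq₁, Ψ.functor.map_comp]
    have sq₂' : Ψ.functor.map γ' ≫ Ψ.functor.map δ' = Ψ.functor.map γ'' ≫ Ψ.functor.map α := by
      rw [← Ψ.functor.map_comp, sq₂, Ψ.functor.map_comp]
    have hde' : PreFrobenioid.DivEquivalent F₂ (Ψ.functor.map γ ≫ Ψ.functor.map β)
        (Ψ.functor.map γ'') := by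
      rw [← Ψ.functor.map_comp]
      exact hdiveq _ _ (PreFrobenioid.IsPreStep.comp F₁ hγ hβ.1).2 hγ''.2 hde
    exact PreFrobenioid.div_eq_invDiv_of_coprimary_squares F₂ hS.isFrobenioid₂ hS.perfect₂
      hS.isotropic₂ hS.perfFactorial₂ _ _ _ _ _ _ _ (hS.preStep_map α hα.1) (hS.preStep_map β hβ.1)
      (hS.preStep_map γ hγ) (hS.preStep_map γ' hγ') (hS.preStep_map δ hδ) (hS.preStep_map γ'' hγ'')
      (hS.preStep_map δ' hδ') sq₁' sq₂' (PreFrobenioid.cartesian_map Ψ hS.preStep_inv cart₁)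
      (PreFrobenioid.cartesian_map Ψ hS.preStep_inv cart₂) (PreFrobenioid.coprimary_map Ψ hS.preStep_inv cop₁)
      (PreFrobenioid.coprimary_map Ψ hS.preStep_inv cop₂) hde'

end FrdI.T49

end Literature.AlgebraicGeometry.Frobenioids
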